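import Summits.BirchSwinnertonDyer.Rank1Residual.Additive.GordChiBranchWuthrichComponent
import Summits.BirchSwinnertonDyer.Rank1Residual.Additive.GordRankZeroChiBranch
import HarnessLib

/-!
# X4♯(G-ord) / X3♯(G-ord), defect 2, analytic rank `0`, EVERY odd `p`: the UPPER half of `BSD(E,p)`
# from PUBLISHED reading-facts + kernel — the typed `χ_p`-branch input DISCHARGED
# (cell `b2b-bsdres`, sub-cell additive-p2, gen 12)

HONEST FRAMING (cell `b2b-bsdres`, run/shared/lean/b2b/bsd-rank1-residual/, verbatim in every
file): the goal of the cell is to DELETE the COMBINATION-SHAPED residual classes of the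
Birch–Swinnerton-Dyer formula for ALL analytic-rank `≤ 1` elliptic curves over `ℚ` — "full BSD
formula for every rank `≤ 1` curve in class `C`" assembled STRICTLY from published theorems — so
that the rank-`≤ 1` remainder becomes exactly the CONSTRUCTION-SHAPED classes, which are TYPED
(missing-input `Prop`s), NOT attempted. This is not "finishing BSD". Sub-cell `additive-p2`
(CLASS-OWNERS row "X3/X4 additive — pot. good ordinary / X3♯(G-ord)"), generation 12: research
route; no claim beyond the stated classes; X3♯(G-ord)/X4♯(G-ord) stay CONSTRUCTION-SHAPED; labels /
census / located gap UNCHANGED; nothing is booked. Theorems only (no definition, no new named fact).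

WHAT. Gen 7 (`GordRankZeroChiBranch.lean`) proved, on X4♯(G-ord) ∩ `I₀*` ∩ {`ρ̄` onto} and on
X3♯(G-ord) ∩ `I₀*`, analytic rank `0`: `Typed.MissingUpperBoundAt W p` (and `BSD(E,p)` on the
`p ∤ #Ш_an` rows; "what remains is EXACTLY the lower half") GRANTED the typed `χ_p`-branch inputs
`ChiBranchLeadingTerm[Odd][BigImage]At W p`. Gen 12 makes those inputs THEOREMS on the (G)-cell from
the componentwise reading-facts (`GordChiBranchKatoComponent.lean`, `GordChiBranchWuthrichComponent.lean`:
Kato 2004 Thm. 17.4 (3) / Wuthrich 2014 Thm. 16, component `i = (p−1)/2`, over `ℚ(μ_{p^∞})`;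
additive-p1's kernel transport [C]; additive-p2's kernel eigen-descent `ℚ(μ_{p^∞}) → ℚ_∞(√p*)` and
generator normalisation; additive-p4's `T = 0` constant terms). Hence, at EVERY odd `p`:

* `ClassX4Gord.missingUpperBoundAt_rankZero_of_katoComponent` — X4♯(G-ord) ∩ `I₀*`, `r_an = 0`,
  `ρ̄_{E,p}` onto (`ram(3)` if `p = 3`): **`ord_p #Ш(E) ≤ ord_p #Ш_an(E)` from the named facts
  [Kato 17.4 (3) component reading] + [Delbourgo 1998 Prop. 4] + [GZK] + [modularity /
  modular parametrisation]** — NO typed input, NO Tamagawa / Manin hypothesis, NO per-pair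
  certificate; `…bsdp_rankZero_of_katoComponent_of_shaAn_unit` — `BSD(E,p)` on the `p ∤ #Ш_an(E)`
  rows (incl. the Tamagawa-obstructed ones); `…missingInputAt_iff_lower_…`,
  `…bsdp_rankZero_of_katoComponent_of_lower` — what remains is EXACTLY the LOWER half over `ℚ`
  (the located gap: the Eisenstein divisibility on the `ω^{(p−1)/2}`-branch, BSTW 1.21(c) ANNOUNCED);
* `ClassX3Gord.missingUpperBoundAt_rankZero_of_wuthrichComponent`, `…bsdp_…_of_shaAn_unit`,
  `…missingInputAt_iff_lower_…` — the X3♯(G-ord) ∩ `I₀*` twins from [Wuthrich Thm. 16 component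
  reading] + [Delbourgo Prop. 4] + [GZK] + [modularity] (`p ∤ c_p(E)` automatic, Kodaira `I₀*`).

Reading-facts are flagged like their product siblings A117/A118 (`Kato-17.4-pgen-branch-split`,
`Wu14-Thm16-pgen-branch-split`; ONE component each). Labels UNCHANGED; X3♯(G-ord)/X4♯(G-ord)
CONSTRUCTION-SHAPED; nothing booked.

References: K. Kato, Astérisque 295 (2004) Thm. 17.4 (3) [Kato2004Asterisque]; C. Wuthrich, Doc.
Math. 19 (2014) Thm. 16 [Wuthrich2014]; D. Delbourgo, Compositio Math. 113 (1998) Prop. 4 (p. 144)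
[Delbourgo1998]; R. Greenberg, LNM 1716 (1999) §5 [GreenbergLNM1716].
-/

noncomputable section

open scoped Classical MatrixGroups ModularForm NumberField

open CongruenceSubgroup WeierstrassCurve NumberField Literature.NumberTheory.EllipticCurves
  Literature.NumberTheory.EllipticCurves.ModularForms
  Literature.NumberTheory.EllipticCurves.Rank1Residual
  Literature.NumberTheory.EllipticCurves.Rank1Residual.Typed
  IsDedekindDomain Rat.HeightOneSpectrum

namespace Summit.BirchSwinnertonDyer.Rank1Residual.Additive

variable {W : WeierstrassCurve ℚ} [W.IsElliptic] [W.IsGloballyMinimal] {p : ℕ} [hp : Fact p.Prime]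

/-! ### §1 X4♯(G-ord) ∩ `I₀*`, rank `0`, big image: the upper half from published facts -/

/-- **X4♯(G-ord) ∩ `I₀*`, `r_an = 0`, `ρ̄_{E,p}` onto (and `ram(3)` if `p = 3`): the UPPER half
`ord_p #Ш(E) ≤ ord_p #Ш_an(E)` from named facts alone** — Kato 2004 Thm. 17.4 (3) read on the
component `i = (p−1)/2` (`hK`), Delbourgo 1998 Prop. 4 (`hDel`), Gross–Zagier–Kolyvagin (`hGZK`),
modularity (`hmod`, `hmodD`) — gen 7's `…of_chiBranch` with BOTH typed branch inputs DISCHARGED by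
`chiBranchLeadingTerm[Odd]BigImageAt_of_katoComponent` (`ord_p j(E) ≥ 0` on the (G)-cell). Every odd
`p`; NO Tamagawa / Manin hypothesis; NO certificate. X4♯(G-ord) stays CONSTRUCTION-SHAPED (the lower
half is the located gap). [cite: Kato2004Asterisque, Thm. 17.4 (3) (p. 273)]
[cite: Delbourgo1998, Prop. 4 (p. 144)] -/
theorem ClassX4Gord.missingUpperBoundAt_rankZero_of_katoComponent
    (hK : Kato2004.charIdeal_dvd_padicLFunctionBranch_component_of_surjective)
    (hDel : Delbourgo1998.prop4_rankZero_pow_dvd_constantCoeff)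
    (hGZK : rank_eq_analyticRank_of_analyticRank_le_one) (hmod : hasEntireLFunction_rat)
    (hmodD : nonempty_modularParametrizationData)
    (hX : ClassX4Gord W p) (he : semistabilityIndex W p = 2) (hr : W.analyticRank = 0)
    (hsurj : Surj W p) (hram3 : p = 3 → Ram W p) :
    MissingUpperBoundAt W p :=
  ClassX4Gord.missingUpperBoundAt_rankZero_of_chiBranch hDel hGZK hmod hmodD
    (chiBranchLeadingTermBigImageAt_of_katoComponent W p hK
      (padicValRat_j_nonneg_of_typeGOrd W p hX.typeGOrd))
    (chiBranchLeadingTermOddBigImageAt_of_katoComponent W p hK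
      (padicValRat_j_nonneg_of_typeGOrd W p hX.typeGOrd))
    hX he hr hsurj hram3

/-- **X4♯(G-ord) ∩ `I₀*`, `r_an = 0`, `ρ̄` onto, `p ∤ #Ш_an(E)`: `BSD(E,p)` from named facts alone**
(in particular on the Tamagawa-obstructed rank-zero pairs). [cite: Kato2004Asterisque, Thm. 17.4 (3) (p. 273)]
[cite: Delbourgo1998, Prop. 4 (p. 144)] -/
theorem ClassX4Gord.bsdp_rankZero_of_katoComponent_of_shaAn_unit
    (hK : Kato2004.charIdeal_dvd_padicLFunctionBranch_component_of_surjective)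
    (hDel : Delbourgo1998.prop4_rankZero_pow_dvd_constantCoeff)
    (hGZK : rank_eq_analyticRank_of_analyticRank_le_one) (hmod : hasEntireLFunction_rat)
    (hmodD : nonempty_modularParametrizationData)
    (hX : ClassX4Gord W p) (he : semistabilityIndex W p = 2) (hr : W.analyticRank = 0)
    (hsurj : Surj W p) (hram3 : p = 3 → Ram W p)
    {q : ℚ} (hq : shaAn W = (q : ℂ)) (hv : padicValRat p q = 0) : BSDp W p :=
  ClassX4Gord.bsdp_rankZero_of_chiBranch_of_shaAn_unit hDel hGZK hmod hmodD
    (chiBranchLeadingTermBigImageAt_of_katoComponent W p hK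
      (padicValRat_j_nonneg_of_typeGOrd W p hX.typeGOrd))
    (chiBranchLeadingTermOddBigImageAt_of_katoComponent W p hK
      (padicValRat_j_nonneg_of_typeGOrd W p hX.typeGOrd))
    hX he hr hsurj hram3 hq hv

/-- **X4♯(G-ord) ∩ `I₀*`, `r_an = 0`, `ρ̄` onto: what remains is EXACTLY the lower half over `ℚ`**
(`Typed.X4.MissingInputAt W p ↔ MissingLowerBoundAt W p`), from named facts alone.
[cite: Kato2004Asterisque, Thm. 17.4 (3) (p. 273)] [cite: Delbourgo1998, Prop. 4 (p. 144)] -/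
theorem ClassX4Gord.missingInputAt_iff_lower_rankZero_of_katoComponent
    (hK : Kato2004.charIdeal_dvd_padicLFunctionBranch_component_of_surjective)
    (hDel : Delbourgo1998.prop4_rankZero_pow_dvd_constantCoeff)
    (hGZK : rank_eq_analyticRank_of_analyticRank_le_one) (hmod : hasEntireLFunction_rat)
    (hmodD : nonempty_modularParametrizationData)
    (hX : ClassX4Gord W p) (he : semistabilityIndex W p = 2) (hr : W.analyticRank = 0)
    (hsurj : Surj W p) (hram3 : p = 3 → Ram W p) :
    X4.MissingInputAt W p ↔ MissingLowerBoundAt W p :=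
  ClassX4Gord.missingInputAt_iff_lower_rankZero_of_chiBranch hDel hGZK hmod hmodD
    (chiBranchLeadingTermBigImageAt_of_katoComponent W p hK
      (padicValRat_j_nonneg_of_typeGOrd W p hX.typeGOrd))
    (chiBranchLeadingTermOddBigImageAt_of_katoComponent W p hK
      (padicValRat_j_nonneg_of_typeGOrd W p hX.typeGOrd))
    hX he hr hsurj hram3

/-- **X4♯(G-ord) ∩ `I₀*`, `r_an = 0`, `ρ̄` onto: `BSD(E,p)` from named facts and the LOWER half over
`ℚ`.** [cite: Kato2004Asterisque, Thm. 17.4 (3) (p. 273)] [cite: Delbourgo1998, Prop. 4 (p. 144)] -/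
theorem ClassX4Gord.bsdp_rankZero_of_katoComponent_of_lower
    (hK : Kato2004.charIdeal_dvd_padicLFunctionBranch_component_of_surjective)
    (hDel : Delbourgo1998.prop4_rankZero_pow_dvd_constantCoeff)
    (hGZK : rank_eq_analyticRank_of_analyticRank_le_one) (hmod : hasEntireLFunction_rat)
    (hmodD : nonempty_modularParametrizationData)
    (hX : ClassX4Gord W p) (he : semistabilityIndex W p = 2) (hr : W.analyticRank = 0)
    (hsurj : Surj W p) (hram3 : p = 3 → Ram W p) (hlow : MissingLowerBoundAt W p) : BSDp W p :=
  ClassX4Gord.bsdp_rankZero_of_chiBranch_of_lower hDel hGZK hmod hmodD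
    (chiBranchLeadingTermBigImageAt_of_katoComponent W p hK
      (padicValRat_j_nonneg_of_typeGOrd W p hX.typeGOrd))
    (chiBranchLeadingTermOddBigImageAt_of_katoComponent W p hK
      (padicValRat_j_nonneg_of_typeGOrd W p hX.typeGOrd))
    hX he hr hsurj hram3 hlow

/-! ### §2 X3♯(G-ord) ∩ `I₀*`, rank `0`: the upper half from published facts (Wuthrich Thm. 16 side) -/

/-- **X3♯(G-ord) ∩ `I₀*` (odd `p`), `r_an = 0`: the UPPER half `ord_p #Ш(E) ≤ ord_p #Ш_an(E)` from
named facts alone** — Wuthrich 2014 Thm. 16 read on the component `i = (p−1)/2` (`hWu`), Delbourgo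
Prop. 4, GZK, modularity — gen 7's `…of_chiBranch'` (`p ∤ c_p(E)` automatic) with both typed branch
inputs DISCHARGED by `chiBranchLeadingTerm[Odd]At_of_wuthrichComponent`. Every odd `p`; no
certificate. X3♯(G-ord) stays CONSTRUCTION-SHAPED. [cite: Wuthrich2014, Thm. 16 (p. 397)]
[cite: Delbourgo1998, Prop. 4 (p. 144)] -/
theorem ClassX3Gord.missingUpperBoundAt_rankZero_of_wuthrichComponent
    (hWu : Wuthrich2014.charIdeal_dvd_padicLFunctionBranch_component)
    (hDel : Delbourgo1998.prop4_rankZero_pow_dvd_constantCoeff)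
    (hGZK : rank_eq_analyticRank_of_analyticRank_le_one) (hmod : hasEntireLFunction_rat)
    (hmodD : nonempty_modularParametrizationData)
    (hp2 : p ≠ 2) (hX : ClassX3Gord W p) (he : semistabilityIndex W p = 2) (hr : W.analyticRank = 0) :
    MissingUpperBoundAt W p :=
  ClassX3Gord.missingUpperBoundAt_rankZero_of_chiBranch' hDel hGZK hmod hmodD
    (chiBranchLeadingTermAt_of_wuthrichComponent W p hWu
      (padicValRat_j_nonneg_of_typeGOrd W p hX.typeGOrd))
    (chiBranchLeadingTermOddAt_of_wuthrichComponent W p hWu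
      (padicValRat_j_nonneg_of_typeGOrd W p hX.typeGOrd))
    hp2 hX he hr

/-- **X3♯(G-ord) ∩ `I₀*` (odd `p`), `r_an = 0`, `p ∤ #Ш_an(E)`: `BSD(E,p)` from named facts alone.**
[cite: Wuthrich2014, Thm. 16 (p. 397)] [cite: Delbourgo1998, Prop. 4 (p. 144)] -/
theorem ClassX3Gord.bsdp_rankZero_of_wuthrichComponent_of_shaAn_unit
    (hWu : Wuthrich2014.charIdeal_dvd_padicLFunctionBranch_component)
    (hDel : Delbourgo1998.prop4_rankZero_pow_dvd_constantCoeff)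
    (hGZK : rank_eq_analyticRank_of_analyticRank_le_one) (hmod : hasEntireLFunction_rat)
    (hmodD : nonempty_modularParametrizationData)
    (hp2 : p ≠ 2) (hX : ClassX3Gord W p) (he : semistabilityIndex W p = 2) (hr : W.analyticRank = 0)
    {q : ℚ} (hq : shaAn W = (q : ℂ)) (hv : padicValRat p q = 0) : BSDp W p :=
  ClassX3Gord.bsdp_rankZero_of_chiBranch_of_shaAn_unit' hDel hGZK hmod hmodD
    (chiBranchLeadingTermAt_of_wuthrichComponent W p hWu
      (padicValRat_j_nonneg_of_typeGOrd W p hX.typeGOrd))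
    (chiBranchLeadingTermOddAt_of_wuthrichComponent W p hWu
      (padicValRat_j_nonneg_of_typeGOrd W p hX.typeGOrd))
    hp2 hX he hr hq hv

/-- **X3♯(G-ord) ∩ `I₀*` (odd `p`), `r_an = 0`: what remains is EXACTLY the lower half over `ℚ`**
(`Gord.MissingInputAt W p ↔ MissingLowerBoundAt W p`), from named facts alone.
[cite: Wuthrich2014, Thm. 16 (p. 397)] [cite: Delbourgo1998, Prop. 4 (p. 144)] -/
theorem ClassX3Gord.missingInputAt_iff_lower_rankZero_of_wuthrichComponent
    (hWu : Wuthrich2014.charIdeal_dvd_padicLFunctionBranch_component)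
    (hDel : Delbourgo1998.prop4_rankZero_pow_dvd_constantCoeff)
    (hGZK : rank_eq_analyticRank_of_analyticRank_le_one) (hmod : hasEntireLFunction_rat)
    (hmodD : nonempty_modularParametrizationData)
    (hp2 : p ≠ 2) (hX : ClassX3Gord W p) (he : semistabilityIndex W p = 2) (hr : W.analyticRank = 0) :
    Gord.MissingInputAt W p ↔ MissingLowerBoundAt W p :=
  ClassX3Gord.missingInputAt_iff_lower_rankZero_of_chiBranch hDel hGZK hmod hmodD
    (chiBranchLeadingTermAt_of_wuthrichComponent W p hWu
      (padicValRat_j_nonneg_of_typeGOrd W p hX.typeGOrd))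
    (chiBranchLeadingTermOddAt_of_wuthrichComponent W p hWu
      (padicValRat_j_nonneg_of_typeGOrd W p hX.typeGOrd))
    hp2 hX he hr

end Summit.BirchSwinnertonDyer.Rank1Residual.Additive

end
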